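import Mathlib
import HarnessLib

/-!
# Zhang (2022) §15 (15.15): from the CLOSED zero-free region of the Part-A package to the OPEN box
# hypotheses of the contour core (a compactness lemma; theorems only)

Topic `Literature/NumberTheory/LFunctions/Zhang2022` (Landau–Siegel audit tree; verdict-neutral).
Y. Zhang, *Discrete mean estimates and the Landau–Siegel zero*, arXiv:2211.02515v1 (2022)
[Zhang2022LandauSiegel] — an unrefereed manuscript under adjudication; nothing here asserts or denies
its Theorems 1–2. Lane ZHANG-L, WP15, leaf `h15_17 : Typed.Section15B.Eq15_17 c′ bChi`, the ranged
(15.15) (`Eq1515.eq15_15_ranged`, owner zl-w15-p1; successor-designate zl-w15-typer g2).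

THE SEAM. The pointwise contour core `Eq1515.core` (Section15BEq1515Core, p480151) asks for the
non-vanishing of `ζ₁(1+z)` and of `L(1+z,χ)` (off the exceptional zero `z = ρ̃ − 1`) on an OPEN box
`a₁ < Re z < 2`, `|Im z| < H₁` with `a₁ < a` and `H < H₁` (`a = −c₁/𝓛` the left abscissa, `H` the
height of Landau's rectangle), whereas the analytic package `Eq1515.phi1515_bounds`
(Section15BEq1515PhiBounds, p478879) exports them on the CLOSED region `Re w ≥ 1 − c₁/𝓛`,
`|Im w| ≤ D/2` (with the exceptional zero `ρ̃`, `1 − ρ̃ ≤ c₁/(2𝓛)`), and its left-line bound sits exactly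
on `Re s = −c₁/𝓛`, so the abscissa cannot be moved inward. This file closes the seam by compactness
alone: non-vanishing of the continuous functions `z ↦ ζ₁(1+z)`, `z ↦ L(1+z,χ)` on the compact box
`[−η, 2] × [−H, H]` (the point `ρ̃ − 1` excepted via a small disc on which the closed-region clause still
applies) holds on an open neighbourhood, which contains a slightly larger open box
(`IsCompact.exists_thickening_subset_open`). No number theory beyond `ζ(w) ≠ 0` for `Re w > 1`
(`riemannZeta_ne_zero_of_one_lt_re`) enters. Output shape = the hypotheses `ha₁/ha₁a/hHH₁/hUζ/hUL`
of `Eq1515.core` verbatim. Theorems only; no definitions; no new claims.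
[cite: Zhang2022LandauSiegel, §15 (15.15)–(15.16) p. 85]

## References
* Y. Zhang, arXiv:2211.02515v1 (2022), §15 (15.15)–(15.16) p. 85. [cite: Zhang2022LandauSiegel, §15 (15.15) p. 85]
-/

noncomputable section

open Complex Real Set Filter Topology Metric
open scoped ComplexConjugate

namespace Literature.NumberTheory.LFunctions.Zhang2022.Eq1515

/-- `ζ₁(1+z) ≠ 0` as soon as `z = 0` or `ζ(1+z) ≠ 0` (`ζ₁(1) = 1`, `ζ₁(w) = (w−1)ζ(w)` for `w ≠ 1`).
[folklore] -/
private theorem riemannZeta₁_one_add_ne_zero {z : ℂ} (h : z ≠ 0 → riemannZeta (1 + z) ≠ 0) :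
    riemannZeta₁ (1 + z) ≠ 0 := by
  by_cases hz : z = 0
  · rw [hz, add_zero, riemannZeta₁_one]; exact one_ne_zero
  · have h1 : (1 : ℂ) + z ≠ 1 := by
      intro h'; apply hz; linear_combination h'
    have hζ := riemannZeta_eq_inv_sub_mul h1
    intro h0
    exact h hz (by rw [hζ, h0, mul_zero])

/-- **Closed zero-free region ⇒ open box for the contour core.** Let `η < 1/10`, `1 ≤ H < R`,
`ρ < 1` with `1 − ρ < η`, `χ ≠ 1`; suppose `L(w,χ) ≠ 0` for `Re w ≥ 1 − η`, `|Im w| ≤ R`, `w ≠ ρ`, and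
`ζ(w) ≠ 0` for `1 − η ≤ Re w ≤ 2`, `|Im w| ≤ R`, `w ≠ 1`. Then there are `a₁ ∈ [−1/10, −η)` and
`H₁ > H` with `ζ₁(1+z) ≠ 0` and (`z ≠ ρ − 1` ⇒ `L(1+z,χ) ≠ 0`) on the open box `a₁ < Re z < 2`,
`|Im z| < H₁` — exactly the inputs `ha₁, ha₁a, hHH₁, hUζ, hUL` of `Eq1515.core`
(feed: `η := c₁/ell D`, `R := D/2`, `ρ := ρ̃` from `Eq1515.phi1515_bounds`).
[cite: Zhang2022LandauSiegel, §15 (15.15)–(15.16) p. 85] -/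
theorem open_box_of_closed_region {D : ℕ} [NeZero D] (χ : DirichletCharacter ℂ D) (hχ1 : χ ≠ 1)
    {η H R ρ : ℝ} (hη10 : η < 1 / 10) (hH : 1 ≤ H) (hHR : H < R)
    (hρ1 : ρ < 1) (hρη : 1 - ρ < η)
    (hL : ∀ w : ℂ, 1 - η ≤ w.re → |w.im| ≤ R → w ≠ (ρ : ℂ) → χ.LFunction w ≠ 0)
    (hζ : ∀ w : ℂ, 1 - η ≤ w.re → w.re ≤ 2 → |w.im| ≤ R → w ≠ 1 → riemannZeta w ≠ 0) :
    ∃ a₁ H₁ : ℝ, -(1 / 10 : ℝ) ≤ a₁ ∧ a₁ < -η ∧ H < H₁ ∧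
      (∀ z : ℂ, a₁ < z.re → z.re < 2 → |z.im| < H₁ → riemannZeta₁ (1 + z) ≠ 0) ∧
      (∀ z : ℂ, a₁ < z.re → z.re < 2 → |z.im| < H₁ → z ≠ ((ρ - 1 : ℝ) : ℂ) →
        χ.LFunction (1 + z) ≠ 0) := by
  classical
  -- radius of the disc around `ρ − 1` on which the closed-region clause still applies
  set r : ℝ := η - (1 - ρ) with hr
  have hr0 : 0 < r := by rw [hr]; linarith
  -- ζ on the closed strip, extended to the right by `Re w > 1`
  have hζ' : ∀ z : ℂ, -η ≤ z.re → |z.im| ≤ R → z ≠ 0 → riemannZeta (1 + z) ≠ 0 := by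
    intro z hz hzi hz0
    by_cases h2 : (1 + z).re ≤ 2
    · refine hζ (1 + z) ?_ h2 ?_ ?_
      · simp; linarith
      · simpa using hzi
      · intro h; apply hz0; linear_combination h
    · exact riemannZeta_ne_zero_of_one_lt_re (by linarith [not_le.mp h2])
  -- L on the closed strip
  have hL' : ∀ z : ℂ, -η ≤ z.re → |z.im| ≤ R → z ≠ ((ρ - 1 : ℝ) : ℂ) → χ.LFunction (1 + z) ≠ 0 := by
    intro z hz hzi hzρ
    refine hL (1 + z) ?_ ?_ ?_
    · simp; linarith
    · simpa using hzi
    · intro h; apply hzρ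
      have : z = (ρ : ℂ) - 1 := by linear_combination h
      rw [this]; push_cast; ring
  -- the open set
  set V : Set ℂ := {z : ℂ | riemannZeta₁ (1 + z) ≠ 0} ∩
    ({z : ℂ | χ.LFunction (1 + z) ≠ 0} ∪ Metric.ball (((ρ - 1 : ℝ) : ℂ)) r) with hV
  have hcζ : Continuous fun z : ℂ => riemannZeta₁ (1 + z) :=
    differentiable_riemannZeta₁.continuous.comp (continuous_const.add continuous_id)
  have hcL : Continuous fun z : ℂ => χ.LFunction (1 + z) :=
    (DirichletCharacter.differentiable_LFunction hχ1).continuous.comp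
      (continuous_const.add continuous_id)
  have hVopen : IsOpen V := by
    refine IsOpen.inter (isOpen_ne_fun hcζ continuous_const) ?_
    exact IsOpen.union (isOpen_ne_fun hcL continuous_const) Metric.isOpen_ball
  -- the compact box `[−η, 2] × [−H, H]` lies in `V`
  set K : Set ℂ := Icc (-η) 2 ×ℂ Icc (-H) H with hK
  have hKc : IsCompact K := (isCompact_Icc).reProdIm isCompact_Icc
  have hHR' : H ≤ R := hHR.le
  have hKV : K ⊆ V := by
    intro z hz
    obtain ⟨⟨hz1, hz2⟩, hz3, hz4⟩ := hz
    have hzi : |z.im| ≤ R := (abs_le.mpr ⟨hz3, hz4⟩).trans hHR'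
    refine ⟨riemannZeta₁_one_add_ne_zero (hζ' z hz1 hzi), ?_⟩
    by_cases hzρ : z = ((ρ - 1 : ℝ) : ℂ)
    · right; rw [hzρ]; exact Metric.mem_ball_self hr0
    · left; exact hL' z hz1 hzi hzρ
  -- thicken
  obtain ⟨δ, hδ0, hδV⟩ := hKc.exists_thickening_subset_open hVopen hKV
  set δ' : ℝ := min (δ / 3) ((1 / 10 - η) / 2) with hδ'
  have hδ'0 : 0 < δ' := by rw [hδ']; exact lt_min (by linarith) (by linarith)
  have hδ'1 : δ' ≤ δ / 3 := min_le_left _ _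
  have hδ'2 : δ' ≤ (1 / 10 - η) / 2 := min_le_right _ _
  refine ⟨-η - δ', H + δ', by linarith, by linarith, by linarith, ?_, ?_⟩
  · -- ζ₁ on the open box
    intro z hz1 hz2 hz3
    have hzV : z ∈ V := by
      refine hδV (Metric.mem_thickening_iff.mpr ?_)
      refine ⟨⟨max z.re (-η), max (min z.im H) (-H)⟩, ⟨⟨le_max_right _ _, ?_⟩, ?_, ?_⟩, ?_⟩
      · exact max_le hz2.le (by linarith)
      · exact le_max_right _ _
      · exact max_le (min_le_right _ _) (by linarith)
      · rw [dist_eq_norm]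
        refine lt_of_le_of_lt (Complex.norm_le_abs_re_add_abs_im _) ?_
        have e1 : |(z - ⟨max z.re (-η), max (min z.im H) (-H)⟩ : ℂ).re| ≤ δ' := by
          simp only [Complex.sub_re]
          rcases le_or_gt (-η) z.re with h | h
          · rw [max_eq_left h, sub_self, abs_zero]; exact hδ'0.le
          · rw [max_eq_right h.le, abs_le]; constructor <;> linarith
        have e2 : |(z - ⟨max z.re (-η), max (min z.im H) (-H)⟩ : ℂ).im| ≤ δ' := by
          simp only [Complex.sub_im]
          have hz3' := abs_lt.mp hz3
          rcases le_or_gt z.im H with h | h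
          · rw [min_eq_left h]
            rcases le_or_gt (-H) z.im with h' | h'
            · rw [max_eq_left h', sub_self, abs_zero]; exact hδ'0.le
            · rw [max_eq_right h'.le, abs_le]; constructor <;> linarith
          · rw [min_eq_right h.le, max_eq_left (by linarith), abs_le]; constructor <;> linarith
        linarith
    exact hzV.1
  · -- L on the open box, off `ρ − 1`
    intro z hz1 hz2 hz3 hzρ
    have hzV : z ∈ V := by
      refine hδV (Metric.mem_thickening_iff.mpr ?_)
      refine ⟨⟨max z.re (-η), max (min z.im H) (-H)⟩, ⟨⟨le_max_right _ _, ?_⟩, ?_, ?_⟩, ?_⟩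
      · exact max_le hz2.le (by linarith)
      · exact le_max_right _ _
      · exact max_le (min_le_right _ _) (by linarith)
      · rw [dist_eq_norm]
        refine lt_of_le_of_lt (Complex.norm_le_abs_re_add_abs_im _) ?_
        have e1 : |(z - ⟨max z.re (-η), max (min z.im H) (-H)⟩ : ℂ).re| ≤ δ' := by
          simp only [Complex.sub_re]
          rcases le_or_gt (-η) z.re with h | h
          · rw [max_eq_left h, sub_self, abs_zero]; exact hδ'0.le
          · rw [max_eq_right h.le, abs_le]; constructor <;> linarith
        have e2 : |(z - ⟨max z.re (-η), max (min z.im H) (-H)⟩ : ℂ).im| ≤ δ' := by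
          simp only [Complex.sub_im]
          have hz3' := abs_lt.mp hz3
          rcases le_or_gt z.im H with h | h
          · rw [min_eq_left h]
            rcases le_or_gt (-H) z.im with h' | h'
            · rw [max_eq_left h', sub_self, abs_zero]; exact hδ'0.le
            · rw [max_eq_right h'.le, abs_le]; constructor <;> linarith
          · rw [min_eq_right h.le, max_eq_left (by linarith), abs_le]; constructor <;> linarith
        linarith
    rcases hzV.2 with h | h
    · exact h
    · -- inside the disc around `ρ − 1`: the closed-region clause applies
      have hd : dist z (((ρ - 1 : ℝ) : ℂ)) < r := Metric.mem_ball.mp h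
      rw [dist_eq_norm] at hd
      have hre : -η ≤ z.re := by
        have h1 : |(z - ((ρ - 1 : ℝ) : ℂ)).re| ≤ ‖z - ((ρ - 1 : ℝ) : ℂ)‖ := Complex.abs_re_le_norm _
        have h2 : |(z - ((ρ - 1 : ℝ) : ℂ)).re| < r := lt_of_le_of_lt h1 hd
        rw [Complex.sub_re, Complex.ofReal_re, abs_lt] at h2
        rw [hr] at h2
        linarith [h2.1]
      have him : |z.im| ≤ R := by
        have h1 : |(z - ((ρ - 1 : ℝ) : ℂ)).im| ≤ ‖z - ((ρ - 1 : ℝ) : ℂ)‖ := Complex.abs_im_le_norm _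
        have h2 : |(z - ((ρ - 1 : ℝ) : ℂ)).im| < r := lt_of_le_of_lt h1 hd
        rw [Complex.sub_im, Complex.ofReal_im, sub_zero] at h2
        have : r ≤ R := by rw [hr]; linarith
        linarith [h2.le]
      exact hL' z hre him hzρ

end Literature.NumberTheory.LFunctions.Zhang2022.Eq1515

end
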